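import Literature.NumberTheory.GaloisRepresentations.InfResTwoExact
import Literature.NumberTheory.GaloisRepresentations.LocalFieldInertiaCdOne
import Literature.NumberTheory.GaloisRepresentations.KummerTwoTorsion
import Literature.NumberTheory.GaloisRepresentations.HilbertNinetySubgroup
import Literature.NumberTheory.GaloisRepresentations.UnramifiedKummer
import Literature.NumberTheory.GaloisRepresentations.BrauerTower
import HarnessLib

/-!
# [AbsAnab] Prop 1.2.1 (vii), sub-DAG row L04 `InfUnramifiedBijective` (= [AbsTopIII] Prop 3.2 (i)
# row P32.i.L02 `inflUnr`): `Inf : H²(G_K/I_K, (K̄ˣ)^{I_K}) ⥲ H²(G_K, K̄ˣ)` — PROVED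

Proof-only file (abc-iut cell, layer L4; sub-DAG `plan/L4/SUBDAG-AbsAnab-Prop121vii.md` row L04,
statements holder abc-iut-w5-d198; also row P32.i.L02 of `plan/L4/SUBDAG-AbsTopIII-Prop32.md`).
S. Mochizuki, *The Absolute Anabelian Geometry of Hyperbolic Curves* (2004) [AbsAnab], proof of
Prop 1.2.1 (vii), p. 11: the residue map of `K` is the composite of the Kummer isomorphism (N1), the
inverse of "the natural isomorphism `H²(Gal(K^unr/K), (K^unr)^×) ⥲ H²(G_K, K̄^×)`" (N2) — the
inflation, an isomorphism because every Brauer class of `K` is split by an unramified extension — and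
the invariant of the unramified Brauer group (N3); [AbsTopIII] Prop 3.2 (i) p. 71 quotes the same
chain ("the natural isomorphism [of Brauer groups] `H²(G^unr, (M^unr_TM)^gp) ⥲ H²(G, M^gp_TM)`").
Classical source: Serre, *Local Fields* XII §1–§2 (`Br(K_nr/K) = Br(K)`), XIII §3.

* `Prop121vii.infUnramified_two_bijective` — **row L04 PROVED**: for an MLF `K` (valued form,
  characteristic `0`), with `I_K = galUnr K` (`= absInertia K`, `galUnr_eq_absInertia`), the inflation
  `H²(G_K/I_K, (K̄ˣ)^{I_K}) → H²(G_K, K̄ˣ)` of Mathlib's continuous cohomology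
  (`ContinuousCohomology.map (G_K → G_K/I_K) ((K̄ˣ)^{I_K} ⊆ K̄ˣ) 2`, `invariantsInclusion`) is
  BIJECTIVE.  Injective: inflation–restriction in degree two (`inf_two_injective`, abc-iut-w5-d214,
  `InfResTwoExact.lean`) with `H¹(I_K, K̄ˣ) = 0` — Hilbert 90 for `Gal(K̄/K^nr)`
  (`subsingleton_one_units_galFixing` at `K^nr = maxUnramified K`, `I_K = Gal(K̄/K^nr)` by
  `mem_absInertia_iff_forall_mem_maxUnramified`).  Surjective: by `exact_inf_res_two` it suffices that
  every class of `H²(G_K, K̄ˣ)` dies on `I_K`; it has finite order `n` and already dies on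
  `Gal(K̄/K_{n})`, `K_n` the unramified extension of degree `n` (`exists_resSub_unrLevel_eq_zero`,
  abc-iut-w5-d174: `Br(K)[n]` is split by `K_n`), and `I_K ≤ Gal(K̄/K_n)`
  (`galUnr_le_galFixing_unramifiedLevel`).

HONEST FRAMING: classical local class field theory; kernel-checking an undisputed step.  Nothing
here bears on [IUTchIII] Cor. 3.12; "proved" refers to this classical statement only.

## References
* [MochizukiAbsAnab2004] S. Mochizuki, *The absolute anabelian geometry of hyperbolic curves* (2004),
  Prop 1.2.1 (vii), proof p. 11 (N2).
* [SerreLocalFields1979] J.-P. Serre, *Local Fields*, GTM 67 (1979), XII §1–§2, XIII §3.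
-/

noncomputable section

universe u

namespace Literature.AnabelianGeometry.AbsoluteAnabelian

namespace Prop121vii

open Field CategoryTheory ValuativeRel ContRepresentation
open Literature.NumberTheory.GaloisRepresentations
open Literature.NumberTheory.GaloisRepresentations.DiscreteGaloisModule
open Literature.NumberTheory.GaloisRepresentations.LocalWeilDatum
open Literature.NumberTheory.GaloisRepresentations.IsNonarchimedeanLocalField

section ResCompose

variable {G : Type u} [Group G] [TopologicalSpace G] [IsTopologicalGroup G]
variable {A : Type u} [AddCommGroup A] [TopologicalSpace A] [DiscreteTopology A]

/-- `res_{G→T} = res_{S→T} ∘ res_{G→S}` on classes, for subgroups `T ≤ S ≤ G` (an instance of the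
tree's `map_comp_apply_of`). [folklore] -/
private theorem resH_eq_resSub_resH (ρ : ContinuousRep G ℤ A) {S T : Subgroup G} (h : T ≤ S) (n : ℕ)
    (z : continuousCohomology n ρ.toTopRep) :
    resH T ρ n z = resSub ρ h n (resH S ρ n z) :=
  map_comp_apply_of (X := ρ.toTopRep) (Y := (ρ.restrict (subgroupIncl S)).toTopRep)
    (Z := (ρ.restrict (subgroupIncl T)).toTopRep) (subgroupIncl S) (inclHom h) (subgroupIncl T)
    (fun _ => rfl) (𝟙 ((ρ.restrict (subgroupIncl S)).toTopRep)) (resSubMod ρ h)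
    (𝟙 ((ρ.restrict (subgroupIncl T)).toTopRep)) (fun _ => rfl) n z

end ResCompose

section Unramified

variable (K : Type u) [Field K] [ValuativeRel K] [TopologicalSpace K] [IsNonarchimedeanLocalField K]
  [CharZero K]

omit [CharZero K] in
/-- `I_K = Gal(K̄/K^nr)`: the subgroup `galUnr K` (`= absInertia K`) is the subgroup of `G_K` fixing
the maximal unramified extension `maxUnramified K` pointwise. [cite: SerreLocalFields1979, IV §4 Cor. 2] -/
theorem galUnr_eq_galFixing_maxUnramified : galUnr K = galFixing K (maxUnramified K) := by
  rw [galUnr_eq_absInertia]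
  ext σ
  rw [mem_absInertia_iff_forall_mem_maxUnramified, mem_galFixing_iff]

omit [CharZero K] in
/-- **Hilbert 90 for `K^nr`**: `H¹(I_K, K̄ˣ) = H¹(Gal(K̄/K^nr), K̄ˣ) = 0`.
[cite: SerreLocalFields1979, X §1 Prop. 2] -/
theorem subsingleton_one_units_galUnr :
    Subsingleton (continuousCohomology 1 (((units K).restrict (subgroupIncl (galUnr K))).toTopRep)) := by
  rw [galUnr_eq_galFixing_maxUnramified]
  exact subsingleton_one_units_galFixing (maxUnramified K)

/-- **Every Brauer class of `K` dies on the inertia group**: `res : H²(G_K, K̄ˣ) → H²(I_K, K̄ˣ)` is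
zero (a class of order `n` is split by the unramified extension `K_n ⊆ K^nr`; Serre XII §2 /
XIII §3 Prop. 7). [cite: SerreLocalFields1979, XIII §3 Prop. 7] -/
theorem resH_galUnr_units_two_eq_zero (z : continuousCohomology 2 (units K).toTopRep) :
    resH (galUnr K) (units K) 2 z = 0 := by
  -- restrict first to `Gal(K̄/⊥) = G_K`, then to the unramified level `K_m`, `m = n f_⊥`
  let E₀ : IntermediateField K (AlgebraicClosure K) := ⊥
  haveI : FiniteDimensional K E₀ := inferInstance
  obtain ⟨n, hn, hz⟩ := exists_resSub_unrLevel_eq_zero K E₀ (resH (galFixing K E₀) (units K) 2 z)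
  have hm : 0 < n * fDeg K E₀ := Nat.mul_pos hn (fDeg_pos K E₀)
  have h₁ : galFixing K (unrLevel K E₀ (n * fDeg K E₀)) ≤ galFixing K E₀ :=
    galFixing_antitone K (le_unrLevel K E₀ (n * fDeg K E₀))
  have hE : unrLevel K E₀ (n * fDeg K E₀) = unramifiedLevel K (n * fDeg K E₀) := bot_sup_eq _
  have h₂ : galUnr K ≤ galFixing K (unrLevel K E₀ (n * fDeg K E₀)) := by
    rw [hE]
    exact galUnr_le_galFixing_unramifiedLevel K hm
  have hcomp : resH (galUnr K) (units K) 2 z =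
      resSub (units K) (h₂.trans h₁) 2 (resH (galFixing K E₀) (units K) 2 z) :=
    resH_eq_resSub_resH (units K) (h₂.trans h₁) 2 z
  have hsplit : resSub (units K) (h₂.trans h₁) 2 (resH (galFixing K E₀) (units K) 2 z) =
      resSub (units K) h₂ 2 (resSub (units K) h₁ 2 (resH (galFixing K E₀) (units K) 2 z)) :=
    (resSub_resSub (units K) h₂ h₁ 2 _).symm
  rw [hcomp, hsplit, hz, map_zero]

/-- **[AbsAnab] Prop 1.2.1 (vii), sub-DAG row L04 `InfUnramifiedBijective` — PROVED** (= [AbsTopIII]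
Prop 3.2 (i) row P32.i.L02): for an MLF `K` (valued form, characteristic `0`) the inflation
`H²(G_K/I_K, (K̄ˣ)^{I_K}) → H²(G_K, K̄ˣ)` (`I_K = galUnr K`, Mathlib continuous cohomology,
`ContinuousCohomology.map (G_K → G_K/I_K) ((K̄ˣ)^{I_K} ⊆ K̄ˣ) 2`) is bijective — "the natural
isomorphism `H²(Gal(K^unr/K), (K^unr)^×) ⥲ H²(G_K, K̄^×)`" of the printed proof (step N2):
injective by inflation–restriction with `H¹(I_K, K̄ˣ) = 0`, surjective because every Brauer class of
`K` is split by an unramified extension. [cite: MochizukiAbsAnab2004, Prop 1.2.1 (vii) p.11] -/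
theorem infUnramified_two_bijective :
    Function.Bijective (ContinuousCohomology.map (ContinuousMonoidHom.quotientMk (galUnr K))
      (invariantsInclusion (galUnr K) (units K)) 2).hom := by
  haveI : IsClosed ((galUnr K : Subgroup (absoluteGaloisGroup K)) : Set (absoluteGaloisGroup K)) :=
    isClosed_galUnr K
  refine ⟨inf_two_injective (galUnr K) (units K) (subsingleton_one_units_galUnr K), fun z => ?_⟩
  exact exists_inf_two_eq_of_resH_eq_zero (galUnr K) (units K) (subsingleton_one_units_galUnr K) z
    (resH_galUnr_units_two_eq_zero K z)

end Unramified

end Prop121vii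

end Literature.AnabelianGeometry.AbsoluteAnabelian

end
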